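import Summits.ValiantsHypothesis.ValiantsHypothesis.Theorems.LacunarySymmetroidMatrixDescartesDoorA26WallBubblingOrderThreeNoBalanceSix
import Summits.ValiantsHypothesis.ValiantsHypothesis.Theorems.LacunarySymmetroidMatrixDescartesDoorA26WallBubblingHermite

/-!
# `DoorA26` / line `wall_bubbling` — ORDER 3 WITH AT MOST SIX TOUCHES LIFTS (no slot maps, no non-degeneracy: Hermite rulings)

HONEST FRAMING.  Object-search cell `pub-symmetroid`, crux `Theses.LacunarySymmetroid.DoorA26` (stmt-ValiantsHypothesis-19979; OPEN, typed,
never asserted).  W2 seat val-sym-door-p1 g20, file #93; def-free helper for obligation (R) of `Cruxes/DoorA26/Lines/wall_bubbling.lean`.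
Imports #91 `…OrderThreeNoBalanceSix` (rulings, pencil calculus) and #67 `…Hermite` (`exists_expSum_hermite`: Hermite interpolation by six-term sums).

THE THEOREM (`mem_twentyLocus_of_orderThree_le_six_touches`).  Injective exponents, symmetric letters, `F = det P`; separated points `z_j` of exact
orders `m_j ∈ {1,2,3}`, `Σ m_j ≥ 20`; ONE triple zero `t⋆`, rank one (`tr P(t⋆) ≠ 0`); the touches are rank one (`tr P(z_j) ≠ 0`), at most SIX, each
either non-parallel (`pol(P(z_j), p⋆) ≠ 0`) or parallel (`P(z_j) = c_j p⋆`) to `p⋆`, the parallel ones inside a finset `Par` of at most FOUR touches.  Then `δ ∈ TwentyLocus` — with NO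
condition on the slope `P′(t⋆)` (the degenerate case `P′(t⋆) ∥ p⋆` of #92 / g19 §7c is absorbed).  Proof against #81 (b): (1) `Q = φ·p⋆` with
`φ(z_j) = [j = j₀]` on the touches kills the non-parallel multipliers (#91); (2) `Q = φ·1` with the HERMITE data `φ = 0` on the parallel touches,
`φ(t⋆) = 0`, `φ′(t⋆) = 1` (≤ 6 conditions, #67) has the slope row `tr p⋆ ≠ 0` as its only non-zero row ⇒ `λ⋆ = 0`; (3) `Q = φ·1` with `φ(t⋆) = 0`,
`φ(z_j) = [j = j₀]` on the parallel touches kills the parallel multipliers.  g19's budget (memo g19 §7c (ii⋆), #76) gives ≤ 3 parallel touches in any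
genuine profile, so the hypothesis «≤ 4» is free there.  Left at order 3 after this file: `|J| = 7` (the core, memo g20 §3) and `|J| = 8`.

WHAT IS HERE.  ★★★ `mem_twentyLocus_of_orderThree_le_six_touches`.  Nothing here bears on `DoorA26`, `DoorA34`, (W)/(M)/(R), `MatrixDescartes` (18050)
or `VP ≠ VNP`; registers unchanged.

[this work] the theorem.
-/

set_option linter.dupNamespace false

namespace Summit.ValiantsHypothesis.ValiantsHypothesis.Theorems.LacunarySymmetroidMatrixDescartes.WallBubbling

open Finset Filter Topology
open Bubbling (TwentyLocus expSum hasDerivAt_expSum)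

/-- ★★★ **ORDER 3 WITH AT MOST SIX TOUCHES LIFTS** (see the module docstring). [this work] -/
theorem mem_twentyLocus_of_orderThree_le_six_touches (δ : Fin 6 → ℝ) (hδ : Function.Injective δ) (S : Fin 6 → Matrix (Fin 2) (Fin 2) ℝ)
    (hS : ∀ l, (S l).IsSymm)
    {r : ℕ} (z : Fin r → ℝ) {ρ : ℝ} (hρ : 0 < ρ) (hsep : ∀ i j : Fin r, i < j → z i + ρ ≤ z j - ρ)
    (m : Fin r → ℕ) (hm1 : ∀ j, 1 ≤ m j) (hm3 : ∀ j, m j ≤ 3) (hm : 20 ≤ ∑ j, m j)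
    (hvan : ∀ j, ∀ i < m j, iteratedDeriv i (fun t => (∑ l, Real.exp (δ l * t) • S l).det) (z j) = 0)
    (htop : ∀ j, iteratedDeriv (m j) (fun t => (∑ l, Real.exp (δ l * t) • S l).det) (z j) ≠ 0)
    (jstar : Fin r) (hjstar : m jstar = 3) (huniq : ∀ j, m j = 3 → j = jstar)
    (htr : (∑ l, Real.exp (δ l * z jstar) • S l).trace ≠ 0)
    (hn6 : (Finset.univ.filter fun j => m j = 2).card ≤ 6)
    (hclass : ∀ j, m j = 2 →
      (((∑ l, Real.exp (δ l * z j) • S l) + (∑ l, Real.exp (δ l * z jstar) • S l)).det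
        - (∑ l, Real.exp (δ l * z j) • S l).det - (∑ l, Real.exp (δ l * z jstar) • S l).det ≠ 0) ∨
      (∃ c : ℝ, (∑ l, Real.exp (δ l * z j) • S l) = c • (∑ l, Real.exp (δ l * z jstar) • S l)))
    (Par : Finset (Fin r)) (hParsub : ∀ j ∈ Par, m j = 2)
    (hParmem : ∀ j, m j = 2 → (∃ c : ℝ, (∑ l, Real.exp (δ l * z j) • S l) = c • (∑ l, Real.exp (δ l * z jstar) • S l)) → j ∈ Par)
    (hpar4 : Par.card ≤ 4)
    (htrj : ∀ j, m j = 2 → (∑ l, Real.exp (δ l * z j) • S l).trace ≠ 0) :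
    δ ∈ TwentyLocus := by
  classical
  rcases mem_twentyLocus_or_generalizedBalance_orderThree δ S hS z hρ hsep m hm1 hm3 hm hvan htop with h | ⟨lam, hl0, hlne, hsimple, hbal⟩
  · exact h
  exfalso
  -- notation
  set P : ℝ → Matrix (Fin 2) (Fin 2) ℝ := fun t => ∑ l, Real.exp (δ l * t) • S l with hP
  set F : ℝ → ℝ := fun t => (P t).det with hF
  set tstar := z jstar with htstar
  set pstar : Matrix (Fin 2) (Fin 2) ℝ := P tstar with hpstar
  have hpsymm : pstar.IsSymm := isSymm_expPencil δ S hS tstar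
  have hdet0 : pstar.det = 0 := by
    have := hvan jstar 0 (by omega); rw [iteratedDeriv_zero] at this; exact this
  have hF1 : deriv F tstar = 0 := by
    have := hvan jstar 1 (by omega); rw [iteratedDeriv_one] at this; exact this
  -- `z` is injective (separated)
  have hzinj : Function.Injective z := by
    intro i j hij
    by_contra hne
    rcases lt_or_gt_of_ne hne with h | h
    · have := hsep i j h; linarith
    · have := hsep j i h; linarith
  -- the shift `φ·Y` in coordinates and its first variation
  have hshift : ∀ (c : Fin 6 → ℝ) (Y : Matrix (Fin 2) (Fin 2) ℝ), Y.IsSymm → ∀ t,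
      (∑ l, Real.exp (δ l * t) • (!![(fun l => c l * Y 0 0) l, (fun l => c l * Y 0 1) l; (fun l => c l * Y 0 1) l, (fun l => c l * Y 1 1) l] :
        Matrix (Fin 2) (Fin 2) ℝ)) = (∑ l, c l * Real.exp (δ l * t)) • Y := by
    intro c Y hY t
    rw [← expPencil_smul_const]
    exact Finset.sum_congr rfl fun l _ => by rw [coordLetter_smul_symm Y hY (c l)]
  -- `expSum a δ` is the six-term sum with coefficients `a`
  have hexp : ∀ (a : Fin 6 → ℝ) (t : ℝ), expSum a δ t = ∑ l, a l * Real.exp (δ l * t) := fun a t => rfl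
  -- STEP 1: every NON-PARALLEL touch multiplier vanishes (ruling `Q = φ·p⋆`, `φ(z_j) = [j = j₀]`)
  have htouch : ∀ j₀, m j₀ = 2 → ((P (z j₀) + pstar).det - (P (z j₀)).det - pstar.det ≠ 0) → lam j₀ = 0 := by
    intro j₀ hj₀ hp
    -- `φ(z_j) = [j = j₀]` on the (≤ 6) touches, by Hermite/Lagrange interpolation
    obtain ⟨c, hc⟩ := exists_expSum_hermite 5 δ hδ ((Finset.univ.filter fun j => m j = 2).image z) (fun _ => 1)
      (by rw [Finset.sum_const, smul_eq_mul, mul_one]; exact (Finset.card_image_le).trans hn6)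
      (fun x _ => if x = z j₀ then 1 else 0)
    have hcval : ∀ j, m j = 2 → (∑ l, c l * Real.exp (δ l * z j)) = if j = j₀ then 1 else 0 := by
      intro j hj
      have hmem : z j ∈ (Finset.univ.filter fun j => m j = 2).image z :=
        Finset.mem_image.2 ⟨j, Finset.mem_filter.2 ⟨Finset.mem_univ _, hj⟩, rfl⟩
      have h := hc (z j) hmem 0 (by norm_num)
      rw [iteratedDeriv_zero, hexp] at h
      rw [h]
      by_cases hjj : j = j₀
      · rw [if_pos hjj, if_pos (by rw [hjj])]
      · rw [if_neg hjj, if_neg (fun h' => hjj (hzinj h'))]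
    -- the coordinate shift of `φ·p⋆`
    let w : Fin 6 → Fin 3 → ℝ := fun l => ![c l * pstar 0 0, c l * pstar 0 1, c l * pstar 1 1]
    have hQ : ∀ t, (∑ l, Real.exp (δ l * t) • (!![w l 0, w l 1; w l 1, w l 2] : Matrix (Fin 2) (Fin 2) ℝ))
        = (∑ l, c l * Real.exp (δ l * t)) • pstar := by
      intro t
      have := hshift c pstar hpsymm t
      simpa only [w, Matrix.cons_val_zero, Matrix.cons_val_one, Matrix.head_cons, Matrix.cons_val_two, Matrix.tail_cons] using this
    have hc1 : ∀ t, ((∑ l, Real.exp (δ l * t) • S l) + (∑ l, Real.exp (δ l * t) • (!![w l 0, w l 1; w l 1, w l 2] : Matrix (Fin 2) (Fin 2) ℝ))).det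
        - (∑ l, Real.exp (δ l * t) • S l).det - (∑ l, Real.exp (δ l * t) • (!![w l 0, w l 1; w l 1, w l 2] : Matrix (Fin 2) (Fin 2) ℝ)).det
        = (∑ l, c l * Real.exp (δ l * t)) * ((P t + pstar).det - (P t).det - pstar.det) := by
      intro t; rw [hQ t, pol_smul_right_fin_two]
    -- admissibility at `t⋆`: `pol(p⋆, p⋆) = 2 det p⋆ = 0`
    have hpp : (pstar + pstar).det - pstar.det - pstar.det = 0 := by
      have : pstar + pstar = (2 : ℝ) • pstar := by rw [two_smul]
      rw [this, Matrix.det_smul, hdet0]; simp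
    have hadm : ∀ j, m j = 3 →
        ((∑ l, Real.exp (δ l * z j) • S l) + (∑ l, Real.exp (δ l * z j) • (!![w l 0, w l 1; w l 1, w l 2] : Matrix (Fin 2) (Fin 2) ℝ))).det
          - (∑ l, Real.exp (δ l * z j) • S l).det
          - (∑ l, Real.exp (δ l * z j) • (!![w l 0, w l 1; w l 1, w l 2] : Matrix (Fin 2) (Fin 2) ℝ)).det = 0 := by
      intro j hj
      rw [huniq j hj, hc1]
      show (∑ l, c l * Real.exp (δ l * tstar)) * ((pstar + pstar).det - pstar.det - pstar.det) = 0
      rw [hpp, mul_zero]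
    have hB := hbal w hadm
    -- evaluate the balance: the `t⋆` row vanishes, the touch rows are `φ(z_j)·pol(p_j, p⋆)`
    have hrow : ∀ j, lam j * (iteratedDeriv (m j) F (z j) *
        iteratedDeriv (m j - 2) (fun t => ((∑ l, Real.exp (δ l * t) • S l)
          + (∑ l, Real.exp (δ l * t) • (!![w l 0, w l 1; w l 1, w l 2] : Matrix (Fin 2) (Fin 2) ℝ))).det
          - (∑ l, Real.exp (δ l * t) • S l).det
          - (∑ l, Real.exp (δ l * t) • (!![w l 0, w l 1; w l 1, w l 2] : Matrix (Fin 2) (Fin 2) ℝ)).det) (z j))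
        = if j = j₀ then lam j₀ * (iteratedDeriv 2 F (z j₀) * ((P (z j₀) + pstar).det - (P (z j₀)).det - pstar.det)) else 0 := by
      intro j
      have hfun : (fun t => ((∑ l, Real.exp (δ l * t) • S l)
          + (∑ l, Real.exp (δ l * t) • (!![w l 0, w l 1; w l 1, w l 2] : Matrix (Fin 2) (Fin 2) ℝ))).det
          - (∑ l, Real.exp (δ l * t) • S l).det
          - (∑ l, Real.exp (δ l * t) • (!![w l 0, w l 1; w l 1, w l 2] : Matrix (Fin 2) (Fin 2) ℝ)).det)
          = fun t => (∑ l, c l * Real.exp (δ l * t)) * ((P t + pstar).det - (P t).det - pstar.det) := funext hc1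
      rw [hfun]
      rcases (by have := hm1 j; have := hm3 j; omega : m j = 1 ∨ m j = 2 ∨ m j = 3) with h | h | h
      · -- simple zero
        rw [hsimple j h, zero_mul]
        have : j ≠ j₀ := fun hj => by rw [hj, hj₀] at h; exact absurd h (by norm_num)
        rw [if_neg this]
      · -- touch: value row `φ(z_j)·pol(p_j,p⋆)` with `φ(z_j) = [j = j₀]`
        rw [h, show (2 : ℕ) - 2 = 0 from rfl, iteratedDeriv_zero, hcval j h]
        by_cases hj : j = j₀
        · subst hj
          rw [if_pos rfl, one_mul, if_pos rfl]
        · rw [if_neg hj, zero_mul, mul_zero, mul_zero, if_neg hj]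
      · -- the triple zero: slope row `φ′(t⋆)·pol(p⋆,p⋆) + φ(t⋆)·F′(t⋆) = 0`
        have hjj : j = jstar := huniq j h
        have hne : j ≠ j₀ := fun hj => by rw [hj] at h; rw [h] at hj₀; exact absurd hj₀ (by norm_num)
        rw [if_neg hne, h, show (3 : ℕ) - 2 = 1 from rfl, iteratedDeriv_one, hjj]
        -- derivative of `φ · g` at `t⋆` with `g(t⋆) = 0` and `g′(t⋆) = F′(t⋆) = 0`
        have hφd : HasDerivAt (fun t => ∑ l, c l * Real.exp (δ l * t)) (∑ l, c l * (δ l * Real.exp (δ l * tstar))) tstar := by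
          have hl : ∀ l, HasDerivAt (fun t => c l * Real.exp (δ l * t)) (c l * (δ l * Real.exp (δ l * tstar))) tstar := by
            intro l
            have h1 : HasDerivAt (fun t => Real.exp (δ l * t)) (Real.exp (δ l * tstar) * (δ l * 1)) tstar :=
              ((hasDerivAt_id tstar).const_mul (δ l)).exp
            exact (h1.const_mul (c l)).congr_deriv (by ring)
          exact HasDerivAt.fun_sum (u := Finset.univ) (fun l _ => hl l)
        have hgd := hasDerivAt_pol_expPencil_const δ S pstar tstar
        -- `g′(t⋆) = F′(t⋆) = 0`
        have hg1 : (∑ l, δ l * Real.exp (δ l * tstar) * S l 0 0) * pstar 1 1 + (∑ l, δ l * Real.exp (δ l * tstar) * S l 1 1) * pstar 0 0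
            - (∑ l, δ l * Real.exp (δ l * tstar) * S l 0 1) * pstar 1 0 - (∑ l, δ l * Real.exp (δ l * tstar) * S l 1 0) * pstar 0 1 = 0 := by
          have hd := deriv_det_expPencil_eq_pol δ S tstar
          have h0 : deriv (fun t => (∑ l, Real.exp (δ l * t) • S l).det) tstar = 0 := hF1
          rw [h0] at hd
          show (∑ l, δ l * Real.exp (δ l * tstar) * S l 0 0) * (P tstar) 1 1 + (∑ l, δ l * Real.exp (δ l * tstar) * S l 1 1) * (P tstar) 0 0
            - (∑ l, δ l * Real.exp (δ l * tstar) * S l 0 1) * (P tstar) 1 0 - (∑ l, δ l * Real.exp (δ l * tstar) * S l 1 0) * (P tstar) 0 1 = 0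
          simp only [hP] at hd ⊢
          linarith
        have hprod : HasDerivAt (fun t => (∑ l, c l * Real.exp (δ l * t)) * ((P t + pstar).det - (P t).det - pstar.det))
            ((∑ l, c l * (δ l * Real.exp (δ l * tstar))) * ((P tstar + pstar).det - (P tstar).det - pstar.det)
              + (∑ l, c l * Real.exp (δ l * tstar)) *
                ((∑ l, δ l * Real.exp (δ l * tstar) * S l 0 0) * pstar 1 1 + (∑ l, δ l * Real.exp (δ l * tstar) * S l 1 1) * pstar 0 0
                  - (∑ l, δ l * Real.exp (δ l * tstar) * S l 0 1) * pstar 1 0 - (∑ l, δ l * Real.exp (δ l * tstar) * S l 1 0) * pstar 0 1)) tstar :=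
          hφd.mul hgd
        rw [← htstar, hprod.deriv, hg1, mul_zero, add_zero]
        have hg0 : (P tstar + pstar).det - (P tstar).det - pstar.det = 0 := hpp
        rw [hg0, mul_zero, mul_zero, mul_zero]
    rw [Finset.sum_congr rfl (fun j _ => hrow j), Finset.sum_ite_eq' Finset.univ j₀, if_pos (Finset.mem_univ _)] at hB
    -- conclude `lam j₀ = 0`
    have hA : iteratedDeriv 2 F (z j₀) ≠ 0 := by have := htop j₀; rwa [hj₀] at this
    rcases mul_eq_zero.1 hB with h | h
    · exact h
    · exact absurd h (mul_ne_zero hA hp)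
  -- touches: parallel ones have `P(z_j) = c_j p⋆` with `c_j ≠ 0`-free consequences: `pol(P(z_j), Y) = c_j pol(p⋆, Y)`
  have hpar_pol : ∀ j (cj : ℝ), P (z j) = cj • pstar → ∀ Y : Matrix (Fin 2) (Fin 2) ℝ,
      (P (z j) + Y).det - (P (z j)).det - Y.det = cj * ((pstar + Y).det - pstar.det - Y.det) := by
    intro j cj hcj Y
    rw [hcj]
    simp only [Matrix.det_fin_two, Matrix.add_apply, Matrix.smul_apply, smul_eq_mul]
    have : pstar 0 0 * pstar 1 1 - pstar 0 1 * pstar 1 0 = 0 := by rw [← Matrix.det_fin_two]; exact hdet0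
    nlinarith [this]
  have hpp0 : (pstar + pstar).det - pstar.det - pstar.det = 0 := by
    have : pstar + pstar = (2 : ℝ) • pstar := by rw [two_smul]
    rw [this, Matrix.det_smul, hdet0]; simp
  -- the parallel touches and `t⋆`
  have htstar_notmem : ∀ j ∈ Par, z j ≠ tstar := by
    intro j hj h
    have hj2 := hParsub j hj
    have : j = jstar := hzinj (by rw [h])
    rw [this, hjstar] at hj2; exact absurd hj2 (by norm_num)
  -- STEP 2: the triple-zero multiplier vanishes (scalar ruling `Q = φ·1`, Hermite data `φ|Par = 0`, `φ(t⋆) = 0`, `φ′(t⋆) = 1`)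
  have hstar : lam jstar = 0 := by
    obtain ⟨c, hc⟩ := exists_expSum_hermite 5 δ hδ (insert tstar (Par.image z)) (fun x => if x = tstar then 2 else 1)
      (by
        rw [Finset.sum_insert (fun hmem => by
          obtain ⟨j, hj, hjz⟩ := Finset.mem_image.1 hmem
          exact htstar_notmem j hj hjz)]
        rw [if_pos rfl]
        have h1 : ∑ x ∈ Par.image z, (if x = tstar then 2 else 1) = ∑ x ∈ Par.image z, 1 := by
          refine Finset.sum_congr rfl fun x hx => ?_
          obtain ⟨j, hj, rfl⟩ := Finset.mem_image.1 hx
          rw [if_neg (htstar_notmem j hj)]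
        rw [h1, Finset.sum_const, smul_eq_mul, mul_one]
        have := (Finset.card_image_le (s := Par) (f := z)).trans hpar4
        omega)
      (fun x k => if x = tstar ∧ k = 1 then 1 else 0)
    have hφ0 : (∑ l, c l * Real.exp (δ l * tstar)) = 0 := by
      have h := hc tstar (Finset.mem_insert_self _ _) 0 (by rw [if_pos rfl]; norm_num)
      rw [iteratedDeriv_zero, hexp] at h
      rw [h]; simp
    have hφ1 : deriv (fun t => ∑ l, c l * Real.exp (δ l * t)) tstar = 1 := by
      have h := hc tstar (Finset.mem_insert_self _ _) 1 (by rw [if_pos rfl]; norm_num)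
      rw [iteratedDeriv_one] at h
      have : (fun t => ∑ l, c l * Real.exp (δ l * t)) = expSum c δ := funext fun t => (hexp c t).symm
      rw [this, h]; simp
    have hφpar : ∀ j ∈ Par, (∑ l, c l * Real.exp (δ l * z j)) = 0 := by
      intro j hj
      have h := hc (z j) (Finset.mem_insert_of_mem (Finset.mem_image_of_mem z hj)) 0 (by
        rw [if_neg (htstar_notmem j hj)]; norm_num)
      rw [iteratedDeriv_zero, hexp] at h
      rw [h, if_neg (fun h' => htstar_notmem j hj h'.1)]
    have hφd : HasDerivAt (fun t => ∑ l, c l * Real.exp (δ l * t)) 1 tstar := by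
      have hd : HasDerivAt (fun t => ∑ l, c l * Real.exp (δ l * t)) (expSum (fun i => c i * δ i) δ tstar) tstar := hasDerivAt_expSum c δ tstar
      rw [← hφ1, hd.deriv]; exact hd
    let w : Fin 6 → Fin 3 → ℝ := fun l => ![c l * (1 : Matrix (Fin 2) (Fin 2) ℝ) 0 0, c l * (1 : Matrix (Fin 2) (Fin 2) ℝ) 0 1,
      c l * (1 : Matrix (Fin 2) (Fin 2) ℝ) 1 1]
    have hQ : ∀ t, (∑ l, Real.exp (δ l * t) • (!![w l 0, w l 1; w l 1, w l 2] : Matrix (Fin 2) (Fin 2) ℝ))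
        = (∑ l, c l * Real.exp (δ l * t)) • (1 : Matrix (Fin 2) (Fin 2) ℝ) := by
      intro t
      have := hshift c 1 Matrix.isSymm_one t
      simpa only [w, Matrix.cons_val_zero, Matrix.cons_val_one, Matrix.head_cons, Matrix.cons_val_two, Matrix.tail_cons] using this
    have hc1 : ∀ t, ((∑ l, Real.exp (δ l * t) • S l) + (∑ l, Real.exp (δ l * t) • (!![w l 0, w l 1; w l 1, w l 2] : Matrix (Fin 2) (Fin 2) ℝ))).det
        - (∑ l, Real.exp (δ l * t) • S l).det - (∑ l, Real.exp (δ l * t) • (!![w l 0, w l 1; w l 1, w l 2] : Matrix (Fin 2) (Fin 2) ℝ)).det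
        = (∑ l, c l * Real.exp (δ l * t)) * (P t).trace := by
      intro t; rw [hQ t, pol_smul_one_fin_two]
    have hadm : ∀ j, m j = 3 →
        ((∑ l, Real.exp (δ l * z j) • S l) + (∑ l, Real.exp (δ l * z j) • (!![w l 0, w l 1; w l 1, w l 2] : Matrix (Fin 2) (Fin 2) ℝ))).det
          - (∑ l, Real.exp (δ l * z j) • S l).det
          - (∑ l, Real.exp (δ l * z j) • (!![w l 0, w l 1; w l 1, w l 2] : Matrix (Fin 2) (Fin 2) ℝ)).det = 0 := by
      intro j hj
      rw [huniq j hj, hc1]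
      show (∑ l, c l * Real.exp (δ l * tstar)) * (P tstar).trace = 0
      rw [hφ0, zero_mul]
    have hB := hbal w hadm
    have hrow : ∀ j, lam j * (iteratedDeriv (m j) F (z j) *
        iteratedDeriv (m j - 2) (fun t => ((∑ l, Real.exp (δ l * t) • S l)
          + (∑ l, Real.exp (δ l * t) • (!![w l 0, w l 1; w l 1, w l 2] : Matrix (Fin 2) (Fin 2) ℝ))).det
          - (∑ l, Real.exp (δ l * t) • S l).det
          - (∑ l, Real.exp (δ l * t) • (!![w l 0, w l 1; w l 1, w l 2] : Matrix (Fin 2) (Fin 2) ℝ)).det) (z j))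
        = if j = jstar then lam jstar * (iteratedDeriv 3 F tstar * (1 * pstar.trace)) else 0 := by
      intro j
      have hfun : (fun t => ((∑ l, Real.exp (δ l * t) • S l)
          + (∑ l, Real.exp (δ l * t) • (!![w l 0, w l 1; w l 1, w l 2] : Matrix (Fin 2) (Fin 2) ℝ))).det
          - (∑ l, Real.exp (δ l * t) • S l).det
          - (∑ l, Real.exp (δ l * t) • (!![w l 0, w l 1; w l 1, w l 2] : Matrix (Fin 2) (Fin 2) ℝ)).det)
          = fun t => (∑ l, c l * Real.exp (δ l * t)) * (P t).trace := funext hc1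
      rw [hfun]
      rcases (by have := hm1 j; have := hm3 j; omega : m j = 1 ∨ m j = 2 ∨ m j = 3) with h | h | h
      · rw [hsimple j h, zero_mul]
        have : j ≠ jstar := fun hj => by rw [hj, hjstar] at h; exact absurd h (by norm_num)
        rw [if_neg this]
      · have hne : j ≠ jstar := fun hj => by rw [hj, hjstar] at h; exact absurd h (by norm_num)
        rw [if_neg hne]
        rcases hclass j h with hnp | ⟨cj, hcj⟩
        · rw [htouch j h hnp, zero_mul]
        · -- parallel touch: `φ(z_j) = 0`
          have hjPar : j ∈ Par := hParmem j h ⟨cj, hcj⟩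
          rw [h, show (2 : ℕ) - 2 = 0 from rfl, iteratedDeriv_zero, hφpar j hjPar]
          ring
      · have hjj : j = jstar := huniq j h
        rw [h, show (3 : ℕ) - 2 = 1 from rfl, iteratedDeriv_one, if_pos hjj, hjj]
        have htrd : HasDerivAt (fun t => (P t).trace)
            ((∑ l, δ l * Real.exp (δ l * tstar) * S l 0 0) + (∑ l, δ l * Real.exp (δ l * tstar) * S l 1 1)) tstar := by
          have hfun : (fun t => (P t).trace) = fun t => (∑ l, Real.exp (δ l * t) • S l) 0 0 + (∑ l, Real.exp (δ l * t) • S l) 1 1 := by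
            funext t; rw [Matrix.trace_fin_two]
          rw [hfun]
          exact (hasDerivAt_expPencil_entry δ S 0 0 tstar).add (hasDerivAt_expPencil_entry δ S 1 1 tstar)
        have hprod : HasDerivAt (fun t => (∑ l, c l * Real.exp (δ l * t)) * (P t).trace)
            (1 * (P tstar).trace + (∑ l, c l * Real.exp (δ l * tstar)) *
              ((∑ l, δ l * Real.exp (δ l * tstar) * S l 0 0) + (∑ l, δ l * Real.exp (δ l * tstar) * S l 1 1))) tstar := hφd.mul htrd
        rw [← htstar, hprod.deriv, hφ0, zero_mul, add_zero]
    rw [Finset.sum_congr rfl (fun j _ => hrow j), Finset.sum_ite_eq' Finset.univ jstar, if_pos (Finset.mem_univ _)] at hB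
    have hA : iteratedDeriv 3 F tstar ≠ 0 := by have := htop jstar; rwa [hjstar] at this
    rcases mul_eq_zero.1 hB with h | h
    · exact h
    · exact absurd h (mul_ne_zero hA (by rw [one_mul]; exact htr))
  -- STEP 3: every PARALLEL touch multiplier vanishes (scalar ruling `Q = φ·1`, `φ(t⋆) = 0`, `φ(z_j) = [j = j₀]` on the parallel touches)
  have hpar : ∀ j₀, m j₀ = 2 → lam j₀ = 0 := by
    intro j₀ hj₀
    rcases hclass j₀ hj₀ with hnp | ⟨cj₀, hcj₀⟩
    · exact htouch j₀ hj₀ hnp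
    have hj₀Par : j₀ ∈ Par := hParmem j₀ hj₀ ⟨cj₀, hcj₀⟩
    obtain ⟨c, hc⟩ := exists_expSum_hermite 5 δ hδ (insert tstar (Par.image z)) (fun _ => 1)
      (by
        rw [Finset.sum_const, smul_eq_mul, mul_one]
        have h1 := Finset.card_insert_le tstar (Par.image z)
        have h2 := (Finset.card_image_le (s := Par) (f := z)).trans hpar4
        omega)
      (fun x _ => if x = z j₀ then 1 else 0)
    have hφstar : (∑ l, c l * Real.exp (δ l * tstar)) = 0 := by
      have h := hc tstar (Finset.mem_insert_self _ _) 0 (by norm_num)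
      rw [iteratedDeriv_zero, hexp] at h
      rw [h, if_neg (fun h' => htstar_notmem j₀ hj₀Par h'.symm)]
    have hφval : ∀ j ∈ Par, (∑ l, c l * Real.exp (δ l * z j)) = if j = j₀ then 1 else 0 := by
      intro j hj
      have h := hc (z j) (Finset.mem_insert_of_mem (Finset.mem_image_of_mem z hj)) 0 (by norm_num)
      rw [iteratedDeriv_zero, hexp] at h
      rw [h]
      by_cases hjj : j = j₀
      · rw [if_pos hjj, if_pos (by rw [hjj])]
      · rw [if_neg hjj, if_neg (fun h' => hjj (hzinj h'))]
    let w : Fin 6 → Fin 3 → ℝ := fun l => ![c l * (1 : Matrix (Fin 2) (Fin 2) ℝ) 0 0, c l * (1 : Matrix (Fin 2) (Fin 2) ℝ) 0 1,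
      c l * (1 : Matrix (Fin 2) (Fin 2) ℝ) 1 1]
    have hQ : ∀ t, (∑ l, Real.exp (δ l * t) • (!![w l 0, w l 1; w l 1, w l 2] : Matrix (Fin 2) (Fin 2) ℝ))
        = (∑ l, c l * Real.exp (δ l * t)) • (1 : Matrix (Fin 2) (Fin 2) ℝ) := by
      intro t
      have := hshift c 1 Matrix.isSymm_one t
      simpa only [w, Matrix.cons_val_zero, Matrix.cons_val_one, Matrix.head_cons, Matrix.cons_val_two, Matrix.tail_cons] using this
    have hc1 : ∀ t, ((∑ l, Real.exp (δ l * t) • S l) + (∑ l, Real.exp (δ l * t) • (!![w l 0, w l 1; w l 1, w l 2] : Matrix (Fin 2) (Fin 2) ℝ))).det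
        - (∑ l, Real.exp (δ l * t) • S l).det - (∑ l, Real.exp (δ l * t) • (!![w l 0, w l 1; w l 1, w l 2] : Matrix (Fin 2) (Fin 2) ℝ)).det
        = (∑ l, c l * Real.exp (δ l * t)) * (P t).trace := by
      intro t; rw [hQ t, pol_smul_one_fin_two]
    have hadm : ∀ j, m j = 3 →
        ((∑ l, Real.exp (δ l * z j) • S l) + (∑ l, Real.exp (δ l * z j) • (!![w l 0, w l 1; w l 1, w l 2] : Matrix (Fin 2) (Fin 2) ℝ))).det
          - (∑ l, Real.exp (δ l * z j) • S l).det
          - (∑ l, Real.exp (δ l * z j) • (!![w l 0, w l 1; w l 1, w l 2] : Matrix (Fin 2) (Fin 2) ℝ)).det = 0 := by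
      intro j hj
      rw [huniq j hj, hc1]
      show (∑ l, c l * Real.exp (δ l * tstar)) * (P tstar).trace = 0
      rw [hφstar, zero_mul]
    have hB := hbal w hadm
    have hrow : ∀ j, lam j * (iteratedDeriv (m j) F (z j) *
        iteratedDeriv (m j - 2) (fun t => ((∑ l, Real.exp (δ l * t) • S l)
          + (∑ l, Real.exp (δ l * t) • (!![w l 0, w l 1; w l 1, w l 2] : Matrix (Fin 2) (Fin 2) ℝ))).det
          - (∑ l, Real.exp (δ l * t) • S l).det
          - (∑ l, Real.exp (δ l * t) • (!![w l 0, w l 1; w l 1, w l 2] : Matrix (Fin 2) (Fin 2) ℝ)).det) (z j))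
        = if j = j₀ then lam j₀ * (iteratedDeriv 2 F (z j₀) * (P (z j₀)).trace) else 0 := by
      intro j
      have hfun : (fun t => ((∑ l, Real.exp (δ l * t) • S l)
          + (∑ l, Real.exp (δ l * t) • (!![w l 0, w l 1; w l 1, w l 2] : Matrix (Fin 2) (Fin 2) ℝ))).det
          - (∑ l, Real.exp (δ l * t) • S l).det
          - (∑ l, Real.exp (δ l * t) • (!![w l 0, w l 1; w l 1, w l 2] : Matrix (Fin 2) (Fin 2) ℝ)).det)
          = fun t => (∑ l, c l * Real.exp (δ l * t)) * (P t).trace := funext hc1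
      rw [hfun]
      rcases (by have := hm1 j; have := hm3 j; omega : m j = 1 ∨ m j = 2 ∨ m j = 3) with h | h | h
      · rw [hsimple j h, zero_mul]
        have : j ≠ j₀ := fun hj => by rw [hj, hj₀] at h; exact absurd h (by norm_num)
        rw [if_neg this]
      · rw [h, show (2 : ℕ) - 2 = 0 from rfl, iteratedDeriv_zero]
        rcases hclass j h with hnp | ⟨cj, hcj⟩
        · -- non-parallel touch: multiplier already zero
          rw [htouch j h hnp, zero_mul]
          have : j ≠ j₀ := fun hj => by rw [hj] at hnp; exact hnp (by rw [hpar_pol j₀ cj₀ hcj₀ pstar, hpp0, mul_zero])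
          rw [if_neg this]
        · have hjPar : j ∈ Par := hParmem j h ⟨cj, hcj⟩
          rw [hφval j hjPar]
          by_cases hj : j = j₀
          · subst hj
            rw [if_pos rfl, one_mul, if_pos rfl]
          · rw [if_neg hj, zero_mul, mul_zero, mul_zero, if_neg hj]
      · have hjj : j = jstar := huniq j h
        have hne : j ≠ j₀ := fun hj => by rw [hj] at h; rw [h] at hj₀; exact absurd hj₀ (by norm_num)
        rw [if_neg hne, hjj, hstar, zero_mul]
    rw [Finset.sum_congr rfl (fun j _ => hrow j), Finset.sum_ite_eq' Finset.univ j₀, if_pos (Finset.mem_univ _)] at hB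
    have hA : iteratedDeriv 2 F (z j₀) ≠ 0 := by have := htop j₀; rwa [hj₀] at this
    rcases mul_eq_zero.1 hB with h | h
    · exact h
    · exact absurd h (mul_ne_zero hA (htrj j₀ hj₀))
  -- all multipliers vanish
  apply hlne
  funext j
  rcases (by have := hm1 j; have := hm3 j; omega : m j = 1 ∨ m j = 2 ∨ m j = 3) with h | h | h
  · exact hsimple j h
  · exact hpar j h
  · rw [huniq j h]; exact hstar

end Summit.ValiantsHypothesis.ValiantsHypothesis.Theorems.LacunarySymmetroidMatrixDescartes.WallBubbling
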